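import Literature.MathematicalPhysics.QuantumFieldTheory.Balaban1983to89.B13ScaledPencilTransport
import Literature.MathematicalPhysics.QuantumFieldTheory.Balaban1983to89.B9Eq358TaxiLettersY
import Literature.MathematicalPhysics.QuantumFieldTheory.Balaban1983to89.B13BlockBondReadingNumerals
import Literature.MathematicalPhysics.QuantumFieldTheory.Balaban1983to89.B13OpsYPencilTransport
import Literature.MathematicalPhysics.QuantumFieldTheory.Balaban1983to89.B13GreenPrimeSymLettersOfReg335
import Literature.MathematicalPhysics.QuantumFieldTheory.Balaban1983to89.B9Eq3104CutoffCommutatorSizes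
import Literature.MathematicalPhysics.QuantumFieldTheory.Balaban1983to89.B13DeltaALocalFamily

/-!
# `Balaban1983to89.B13ScaledPencilAveraging` — T. Bałaban, *Propagators for lattice gauge theories in a background field*, Commun. Math. Phys. **99** (1985) 389–434
# [Balaban1985BackgroundPropagators], (3.19)–(3.21) pp. 393–394 (the block averaging `Q′` and its transporters `U(Γ_{y,x})`, `x ∈ Bʲ(y)`), (3.24) p. 394 (`Q′*`), (3.35)–(3.37)
# p. 396 («|A′| < α₁(Lʲη)⁻¹ on Ω_j» — the complex neighbourhood is WEIGHTED BY THE LOCAL SCALE), (3.40) p. 397, Thm 3.4 p. 400; [Balaban1988RG2Cluster] p. 15 (the complexified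
# configuration `U = U′U₀`); [Balaban1984PropagatorsII] (2.1)–(2.4) p. 224 (blocks of side `Lʲ` in `Ω_j`), (2.45) p. 231:
# ★★ STATION W4 OF THE (3.37)-SCALED RE-READ OF THE N10 LETTERS — module 73's block-averaging transporter facts (`qpT`, both of def-Y's letters) ALONG THE SCALED PENCIL
# `A″ ↦ e^{iη·w·A″}U₀` with a blockwise weight `|w| ≤ (L^{lev})⁻¹`, read BLOCK BY BLOCK on the corner box of the site's own block (dag-n10-w3 g5's W1–W3): ONE transporter
# numeral `KQ = K₀^{(d+1)(L^k−1)}·e^{(d+1)|η|Rc}` whose exponent does not see the level, and `KQ = e^{(d+1)|η|Rc}` at a unitary-valued background (the lane's corollary of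
# record, I.39586) — in the `hQh hQhi hQf hQb hQsf hQsb` format of dag-n10-w6 g4's L3 §1 ∕ this seat's `B13DirichletLocalXLetters` §2.

statement-level bookkeeping over pv27's `prodCfg`, node00-def-Y's transporters (`parTaxiV ∕ parSY ∕ parSymY ∕ qpT ∕ qpK ∕ qpsK`), dag-n10-w3 g5's W3 `B13ScaledPencilTransport`
(the box word-length bound at the scaled pencil) and r06's `B9Eq358TaxiLettersY` (the block of `𝔅` IS the torus box of side `L^{lev}` at its corner: `val_sub_corner`,
`blkOf_toBox_of_val_sub_lt`, `pow_dvd_period_and_two_mul_le`, `toLex_corner_le`) BY NAME, with citation tags; [folklore] real arithmetic; THEOREMS ONLY (no `def`, no instance,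
no notation); nothing of NODE 00's modified; nothing here is a claim about the Yang–Mills mass gap; no node is discharged; count-neutral.

WHY THIS FILE (cell `pub-ymgap`, HUMAN RULING D-0062, Track A node N10 = [B13] → N06 row 17; width seat `pub-ymgap-dag-n10-w5` g4; LOCATED (c) of the local-cube road,
I.38012: along the PLAIN pencil every station's radius is `∝ L^{−k}` because the transporter numerals carry `(K₀e^{|η|Rc})^{D}` with the TOP-LEVEL range `D ∼ (d+1)L^k`;
print weighs the field by the local scale, (3.37), so that on a block of level `j` the contour length `≲ (d+1)Lʲ` meets a field `≲ L^{−j}·Rc` — the product is level-free).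
W3 typed the leaf (the box bound with the radius ON THE BOX); this file reads NODE 00's block-averaging transporters through it: for `qpK(s,z) ≠ 0` the site `z` lies in the
block `s`, the block is the corner box of side `L^{lev s}` (r06), the weight there is `≤ L^{−lev s}`, the word from the corner has `≤ (d+1)(L^{lev s} − 1)` letters, and
`(K₀e^{|η|L^{−j}Rc})^{(d+1)(Lʲ−1)} ≤ K₀^{(d+1)(L^k−1)}·e^{(d+1)|η|Rc}`.  Stations 75∕76∕78 and the X∕R∕Δ_a∕C stations are re-read over these binders unchanged in shape
(dag-n10-w4 g6's W5 for 75∕76; the bond-averaging transporters `qT` of `Q ∕ Q*` are NOT in this file — their averaging box can leave the level shell, see HONEST FRAMING).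

WHAT THIS FILE PROVES (all `theorem`s; any complete normed `ℂ`-algebra `𝔸` with `‖1‖ = 1`; the weight `w : Site → ℝ` is a BINDER with
`hw : ∀ y, |w y| ≤ (L^{lev (blkOf (toBox y))})⁻¹`; the scaled pencil is the family `u ↦ prodCfg U₀ η (fun μ y => (w y : ℂ) • u μ y)`).
* §1 `tdist_chart_corner_le_level` (the block's taxicab diameter at its OWN level), `pow_scaled_le_uniform` (the numeral bookkeeping), ★★ `norm_parTaxiV_scaledPencil_corner_le` ∕
  `…_inv_…` (`blkOf z = s`, `‖A″‖ < Rc`, `‖U₀^{±1}‖ ≤ K₀`, `1 ≤ K₀` ⟹ `‖U(Γ_{corner s, z})^{±1}‖ ≤ K₀^{(d+1)(L^k−1)}·e^{(d+1)|η|Rc}` at `U = e^{iη·w·A″}U₀`),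
  `qpT_parSymY_eq_of_blkOf_eq` (at the v4 letter the transporter of a site of the block is the plain corner word — the corner precedes its sites lexicographically),
  ★★ `norm_qpT_parSymY_scaledPencil_binders` (the FOUR binders `hQf ∕ hQb ∕ hQsf ∕ hQsb` at `parSymY`, one numeral; at def-Y's v2 letter `parSY` the four facts ARE
  `norm_parTaxiV_scaledPencil_corner_le ∕ _inv_` by `rfl`, `qpT i parSY U s z = U(Γ_{corner s, z})`).
* §2 `abs_weight_le_one`, ★ `differentiableOn_parTaxiV_scaledPencil ∕ _inv_` (holomorphy on the chart ball: pv27's pencil holomorphy ∘ the linear scaling, which maps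
  the ball into itself — dag-n10-w4 g6's `differentiable_weightScale ∕ mapsTo_weightScale_ball` BY NAME), ★ `differentiableOn_qpT_parSymY_scaledPencil` (`hQh ∧ hQhi` at
  `parSymY`, both branches).
* §3 ★★★ `norm_qpT_parSymY_scaledPencil_binders_of_mem` — `G ≤ U(N)`, `G`-valued `U₀`: the four binders with **`KQ = e^{(d+1)|η|Rc}`** (no `L^k`, no level, no member size).
HONEST FRAMING: [folklore] bookkeeping over cited tree theorems; which weight is «of record» (print's `(L^{lev}η)⁻¹` against the chart's `η`) and which backgrounds ∕ readings
are of record is NODE 00's ∕ def-T's word — the weight stays a binder; the BOND-averaging transporters (`qT i parBY`, 75∕76's `Q ∕ Q*`) are not re-read here: by w4's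
`exists_run_of_qK_ne_zero` their support box (side `≤ 2L^{j}` around a level-`j` coarse bond) can leave the level-`j` shell, so the blockwise weight bound needs the
multi-level separation geometry or a displayed box-weight binder (next edition); nothing of Bałaban's asserted beyond the cited theorems; N06 ∕ N10 NOT discharged; K1⁹ NOT
closed; counts unmoved (typed 28∕28 · discharged 5∕27); 0 `def`, 0 `sorry`, standard axioms; one finite 𝕋⁴ programme at fixed ε — R4 closes the conditional finite-𝕋⁴ rung
`BalabanLadder.UV` only; the YM mass gap (Clay) is NOT proved by any of this; nothing continuum ∕ ℝ⁴ ∕ OS.  Filed `--kind proof --supports` K1⁹ (stmt-QuantumFields-27364).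
-/

noncomputable section

namespace Literature.MathematicalPhysics.QuantumFieldTheory.Balaban1983to89.B13ScaledPencilAveraging

open Metric Set Finset
open scoped Matrix Matrix.Norms.L2Operator
open Literature.MathematicalPhysics.QuantumFieldTheory.Balaban1983to89
open Literature.MathematicalPhysics.QuantumFieldTheory.Balaban1983to89.B6KLevelCensusIndexV1 (KIdx)
open Literature.MathematicalPhysics.QuantumFieldTheory.Balaban1983to89.B6GlobalChartV1 (PV boxEquiv toBox)
open Literature.MathematicalPhysics.QuantumFieldTheory.Balaban1983to89.B6Geom246MultiLevelBox (blkOf)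
open Literature.MathematicalPhysics.QuantumFieldTheory.Balaban1983to89.B13BlockBondReadingNumerals (tdist_chart_le_of_blk_eq blk_blkCornerY_eq level_le)
open Literature.MathematicalPhysics.QuantumFieldTheory.Balaban1983to89.B9Eq358TaxiLettersY
  (pow_dvd_period_and_two_mul_le val_sub_corner val_sub_corner_self blkOf_toBox_of_val_sub_lt toLex_corner_le)
open Literature.MathematicalPhysics.QuantumFieldTheory.Balaban1983to89.B9Eq39Adjoint (prodCfg)
open Literature.MathematicalPhysics.QuantumFieldTheory.Balaban1983to89.B13OpsYPencilTransport (differentiableOn_parTaxiV_prodCfg differentiableOn_parTaxiV_inv_prodCfg)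
open Literature.MathematicalPhysics.QuantumFieldTheory.Balaban1983to89.B13ScaledPencilTransport (norm_parTaxiV_scaledPencil_le_of_box norm_parTaxiV_inv_scaledPencil_le_of_box)
open Literature.MathematicalPhysics.QuantumFieldTheory.Balaban1983to89.B9Eq3104CutoffCommutatorSizes (qpK_ne_zero_imp qpsK_ne_zero_imp)
open Literature.MathematicalPhysics.QuantumFieldTheory.Balaban1983to89.B13GreenPrimeSymLettersOfReg335 (norm_unit_le_one_of_mem)
open Literature.MathematicalPhysics.QuantumFieldTheory.Balaban1983to89.B13DeltaALocalFamily (differentiable_weightScale mapsTo_weightScale_ball)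
open Literature.MathematicalPhysics.QuantumFieldTheory.Balaban1983to89.Node00

variable {𝔸 : Type} [NormedRing 𝔸] [NormedAlgebra ℂ 𝔸] [CompleteSpace 𝔸] [NormOneClass 𝔸]
variable {d ℓ : ℕ} {hd : 1 ≤ d + 1} {hL : Odd (ℓ + 1) ∧ 1 < ℓ + 1} {b₀ b₁ : ℝ}
variable (i : KIdx d ℓ hd hL b₀ b₁) (U₀ : CfgY 𝔸 i) (η : ℝ) {K₀ Rc : ℝ} (w : Site (PV d ℓ i.m i.K hd hL) 0 → ℝ)

/-! ## §1. ★★ The block-averaging transporter along the (3.37)-SCALED pencil: ONE numeral, uniform in the level -/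

section Scaled

omit [NormedAlgebra ℂ 𝔸] [CompleteSpace 𝔸] [NormOneClass 𝔸] in
/-- a site of the block `s` is within `(d+1)(L^{lev s} − 1)` taxicab steps of the corner — the block's diameter at ITS OWN level (w4's `tdist_chart_le_of_blk_eq` at the side
`L^{lev s}`). [cite: Balaban1984PropagatorsII, (2.1) p.224, (2.45) p.231; Balaban1985BackgroundPropagators, (3.19) p.393, (3.40) p.397, bookkeeping] -/
theorem tdist_chart_corner_le_level {z : SiteY i} {s : BlkY i} (h : blkOf i.D.toDomains z = s) :
    Site.tdist ((boxEquiv i.hN).symm (blkCornerY i s)) ((boxEquiv i.hN).symm z) ≤ (d + 1) * ((ℓ + 1) ^ s.1.1 - 1) :=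
  tdist_chart_le_of_blk_eq i (Nat.pow_pos (Nat.succ_pos ℓ)) (blk_blkCornerY_eq i h).symm

omit [NormedAlgebra ℂ 𝔸] [CompleteSpace 𝔸] [NormOneClass 𝔸] in
/-- the numeral bookkeeping: `(K₀·e^{|η|·(L^{−j}·Rc)})^{t} ≤ K₀^{(d+1)(L^k − 1)}·e^{(d+1)·|η|·Rc}` for `t ≤ (d+1)(Lʲ − 1)`, `j ≤ k`, `1 ≤ K₀`, `0 ≤ Rc` — the exponent
`|η|·L^{−j}Rc·(d+1)(Lʲ − 1) ≤ (d+1)|η|Rc` is UNIFORM IN THE LEVEL. [cite: Balaban1985BackgroundPropagators, (3.37) p.396, (3.40) p.397, bookkeeping] -/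
theorem pow_scaled_le_uniform (hK1 : 1 ≤ K₀) (hRc : 0 ≤ Rc) {j t : ℕ} (hj : j ≤ i.k) (ht : t ≤ (d + 1) * ((ℓ + 1) ^ j - 1)) :
    (K₀ * Real.exp (|η| * (((((ℓ : ℝ) + 1) ^ j)⁻¹) * Rc))) ^ t ≤ K₀ ^ ((d + 1) * ((ℓ + 1) ^ i.k - 1)) * Real.exp (((d : ℝ) + 1) * (|η| * Rc)) := by
  have hLj : (0 : ℝ) < ((ℓ : ℝ) + 1) ^ j := by positivity
  have he0 : 0 ≤ |η| * (((((ℓ : ℝ) + 1) ^ j)⁻¹) * Rc) := by positivity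
  have hb1 : 1 ≤ K₀ * Real.exp (|η| * (((((ℓ : ℝ) + 1) ^ j)⁻¹) * Rc)) := one_le_mul_of_one_le_of_one_le hK1 (Real.one_le_exp he0)
  refine (pow_le_pow_right₀ hb1 ht).trans ?_
  rw [mul_pow, ← Real.exp_nat_mul]
  have hjk : (d + 1) * ((ℓ + 1) ^ j - 1) ≤ (d + 1) * ((ℓ + 1) ^ i.k - 1) :=
    Nat.mul_le_mul_left _ (Nat.sub_le_sub_right (Nat.pow_le_pow_right (Nat.succ_pos ℓ) hj) 1)
  refine mul_le_mul (pow_le_pow_right₀ hK1 hjk) (Real.exp_le_exp.2 ?_) (Real.exp_pos _).le (by positivity)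
  have hcast : ((((d + 1) * ((ℓ + 1) ^ j - 1) : ℕ)) : ℝ) = ((d : ℝ) + 1) * (((ℓ : ℝ) + 1) ^ j - 1) := by
    rw [Nat.cast_mul, Nat.cast_sub (Nat.one_le_pow _ _ (Nat.succ_pos ℓ))]; push_cast; ring
  rw [hcast]
  have hfrac : (((ℓ : ℝ) + 1) ^ j - 1) * ((((ℓ : ℝ) + 1) ^ j)⁻¹) ≤ 1 := by
    rw [sub_mul, mul_inv_cancel₀ hLj.ne', one_mul]
    linarith [inv_nonneg.2 hLj.le]
  calc ((d : ℝ) + 1) * (((ℓ : ℝ) + 1) ^ j - 1) * (|η| * (((((ℓ : ℝ) + 1) ^ j)⁻¹) * Rc))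
      = ((d : ℝ) + 1) * (|η| * Rc) * ((((ℓ : ℝ) + 1) ^ j - 1) * ((((ℓ : ℝ) + 1) ^ j)⁻¹)) := by ring
    _ ≤ ((d : ℝ) + 1) * (|η| * Rc) * 1 := mul_le_mul_of_nonneg_left hfrac (by positivity)
    _ = ((d : ℝ) + 1) * (|η| * Rc) := mul_one _

/-- ★★ **THE BLOCK-AVERAGING TRANSPORTER ALONG THE SCALED PENCIL, LEVEL-UNIFORM.**  For a real weight `w` on the torus with `|w(y)| ≤ (L^{lev y})⁻¹` (`lev y` the level of
`y`'s block of `𝔅`), a pencil parameter `‖A″‖ < Rc`, `‖U₀^{±1}‖ ≤ K₀`, `1 ≤ K₀`, and a site `z` of the block `s`: the taxicab transporter of `U = e^{iη·w·A″}U₀` from the corner of `s`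
to `z` obeys `‖U(Γ)‖ ≤ K₀^{(d+1)(L^k−1)}·e^{(d+1)|η|Rc}` — W3's box bound on the corner box of `s` (r06's `B9Eq358TaxiLettersY`: the box of side `L^{lev s}` at the corner IS the
block, `2L^{lev s} ≤ N`), radius `L^{−lev s}·Rc` there, word length `≤ (d+1)(L^{lev s} − 1)`; the exponent does not see the level.
[cite: Balaban1985BackgroundPropagators, (3.19), (3.21) pp.393–394, (3.35)–(3.37) p.396, (3.40) p.397, Thm 3.4 p.400; Balaban1988RG2Cluster, p.15; Balaban1984PropagatorsII, (2.1) p.224] -/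
theorem norm_parTaxiV_scaledPencil_corner_le (hU : ∀ μ x, ‖(U₀ μ x : 𝔸)‖ ≤ K₀) (hUi : ∀ μ x, ‖(((U₀ μ x)⁻¹ : 𝔸ˣ) : 𝔸)‖ ≤ K₀) (hK1 : 1 ≤ K₀)
    (hRc : 0 ≤ Rc) (hw : ∀ y, |w y| ≤ ((((ℓ : ℝ) + 1) ^ (blkOf i.D.toDomains (toBox i.hN y)).1.1))⁻¹)
    {u : Fin (d + 1) → Site (PV d ℓ i.m i.K hd hL) 0 → 𝔸} (hu : u ∈ ball (0 : Fin (d + 1) → Site (PV d ℓ i.m i.K hd hL) 0 → 𝔸) Rc)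
    {z : SiteY i} {s : BlkY i} (h : blkOf i.D.toDomains z = s) :
    ‖(parTaxiV (prodCfg U₀ η (fun μ y => ((w y : ℝ) : ℂ) • u μ y)) ((boxEquiv i.hN).symm (blkCornerY i s)) ((boxEquiv i.hN).symm z) : 𝔸)‖ ≤
      K₀ ^ ((d + 1) * ((ℓ + 1) ^ i.k - 1)) * Real.exp (((d : ℝ) + 1) * (|η| * Rc)) := by
  have hbox := norm_parTaxiV_scaledPencil_le_of_box U₀ η ((boxEquiv i.hN).symm (blkCornerY i s)) (fun _ => (ℓ + 1) ^ s.1.1)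
    (fun _ => (pow_dvd_period_and_two_mul_le i s).2) (zero_le_one.trans hK1) (fun μ y _ => hU μ y) (fun μ y _ => hUi μ y) w
    (w₀ := ((((ℓ : ℝ) + 1) ^ s.1.1))⁻¹) (by positivity)
    (fun y hy => by have hy' := hw y; rwa [blkOf_toBox_of_val_sub_lt i s y hy] at hy') hu
    (val_sub_corner_self i s) (fun μ => (val_sub_corner i s h μ).2)
  exact hbox.trans (pow_scaled_le_uniform i η hK1 hRc (level_le i s) (tdist_chart_corner_le_level i h))

/-- ★★ **… and its inverse `U(Γ)⁻¹`.** [cite: Balaban1985BackgroundPropagators, (3.5) p.391, (3.24) p.394, (3.35)–(3.37) p.396, (3.40) p.397] -/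
theorem norm_parTaxiV_inv_scaledPencil_corner_le (hU : ∀ μ x, ‖(U₀ μ x : 𝔸)‖ ≤ K₀) (hUi : ∀ μ x, ‖(((U₀ μ x)⁻¹ : 𝔸ˣ) : 𝔸)‖ ≤ K₀) (hK1 : 1 ≤ K₀)
    (hRc : 0 ≤ Rc) (hw : ∀ y, |w y| ≤ ((((ℓ : ℝ) + 1) ^ (blkOf i.D.toDomains (toBox i.hN y)).1.1))⁻¹)
    {u : Fin (d + 1) → Site (PV d ℓ i.m i.K hd hL) 0 → 𝔸} (hu : u ∈ ball (0 : Fin (d + 1) → Site (PV d ℓ i.m i.K hd hL) 0 → 𝔸) Rc)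
    {z : SiteY i} {s : BlkY i} (h : blkOf i.D.toDomains z = s) :
    ‖(((parTaxiV (prodCfg U₀ η (fun μ y => ((w y : ℝ) : ℂ) • u μ y)) ((boxEquiv i.hN).symm (blkCornerY i s)) ((boxEquiv i.hN).symm z))⁻¹ :
        (𝔸)ˣ) : 𝔸)‖ ≤ K₀ ^ ((d + 1) * ((ℓ + 1) ^ i.k - 1)) * Real.exp (((d : ℝ) + 1) * (|η| * Rc)) := by
  have hbox := norm_parTaxiV_inv_scaledPencil_le_of_box U₀ η ((boxEquiv i.hN).symm (blkCornerY i s)) (fun _ => (ℓ + 1) ^ s.1.1)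
    (fun _ => (pow_dvd_period_and_two_mul_le i s).2) (zero_le_one.trans hK1) (fun μ y _ => hU μ y) (fun μ y _ => hUi μ y) w
    (w₀ := ((((ℓ : ℝ) + 1) ^ s.1.1))⁻¹) (by positivity)
    (fun y hy => by have hy' := hw y; rwa [blkOf_toBox_of_val_sub_lt i s y hy] at hy') hu
    (val_sub_corner_self i s) (fun μ => (val_sub_corner i s h μ).2)
  exact hbox.trans (pow_scaled_le_uniform i η hK1 hRc (level_le i s) (tdist_chart_corner_le_level i h))

omit [NormOneClass 𝔸] in
/-- at the v4 letter the block-averaging transporter of a site OF THE BLOCK is the plain taxicab word from the corner (the corner precedes its sites in the chart's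
lexicographic order, r06's `toLex_corner_le`): `qpT i parSymY U s z = U(Γ_{corner s, z})`. [cite: Balaban1985BackgroundPropagators, (3.19) p.393, (3.40) p.397, bookkeeping] -/
theorem qpT_parSymY_eq_of_blkOf_eq (U : CfgY 𝔸 i) {z : SiteY i} {s : BlkY i} (h : blkOf i.D.toDomains z = s) :
    qpT i (parSymY i) U s z = parTaxiV U ((boxEquiv i.hN).symm (blkCornerY i s)) ((boxEquiv i.hN).symm z) := by
  show parSymY i U (blkCornerY i s) z = _
  rw [parSymY_of_le (toLex_corner_le i s h)]
  rfl

/-- ★★ **THE FOUR TRANSPORTER BINDERS OF THE X-STATION (`hQf ∕ hQb ∕ hQsf ∕ hQsb` of w6's L3 §1 ∕ this seat's X §2) AT THE v4 LETTER `parSymY` ALONG THE SCALED PENCIL,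
ONE LEVEL-FREE NUMERAL** `KQ = K₀^{(d+1)(L^k−1)}·e^{(d+1)|η|Rc}` (`qpK s z ≠ 0 ⇒ blkOf z = s`, `qpsK z s ≠ 0 ⇒ blkOf z = s`).
[cite: Balaban1985BackgroundPropagators, (3.19), (3.21), (3.24) pp.393–394, (3.35)–(3.37) p.396, (3.40) p.397; Balaban1988RG2Cluster, p.15] -/
theorem norm_qpT_parSymY_scaledPencil_binders (hU : ∀ μ x, ‖(U₀ μ x : 𝔸)‖ ≤ K₀) (hUi : ∀ μ x, ‖(((U₀ μ x)⁻¹ : 𝔸ˣ) : 𝔸)‖ ≤ K₀)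
    (hK1 : 1 ≤ K₀) (hRc : 0 ≤ Rc) (hw : ∀ y, |w y| ≤ ((((ℓ : ℝ) + 1) ^ (blkOf i.D.toDomains (toBox i.hN y)).1.1))⁻¹) :
    (∀ u ∈ ball (0 : Fin (d + 1) → Site (PV d ℓ i.m i.K hd hL) 0 → 𝔸) Rc, ∀ s z, qpK i s z ≠ 0 →
      ‖(qpT i (parSymY i) (prodCfg U₀ η (fun μ y => ((w y : ℝ) : ℂ) • u μ y)) s z : 𝔸)‖ ≤
        K₀ ^ ((d + 1) * ((ℓ + 1) ^ i.k - 1)) * Real.exp (((d : ℝ) + 1) * (|η| * Rc))) ∧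
    (∀ u ∈ ball (0 : Fin (d + 1) → Site (PV d ℓ i.m i.K hd hL) 0 → 𝔸) Rc, ∀ s z, qpK i s z ≠ 0 →
      ‖(((qpT i (parSymY i) (prodCfg U₀ η (fun μ y => ((w y : ℝ) : ℂ) • u μ y)) s z)⁻¹ : 𝔸ˣ) : 𝔸)‖ ≤
        K₀ ^ ((d + 1) * ((ℓ + 1) ^ i.k - 1)) * Real.exp (((d : ℝ) + 1) * (|η| * Rc))) ∧
    (∀ u ∈ ball (0 : Fin (d + 1) → Site (PV d ℓ i.m i.K hd hL) 0 → 𝔸) Rc, ∀ z s, qpsK i z s ≠ 0 →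
      ‖(((qpT i (parSymY i) (prodCfg U₀ η (fun μ y => ((w y : ℝ) : ℂ) • u μ y)) s z)⁻¹ : 𝔸ˣ) : 𝔸)‖ ≤
        K₀ ^ ((d + 1) * ((ℓ + 1) ^ i.k - 1)) * Real.exp (((d : ℝ) + 1) * (|η| * Rc))) ∧
    (∀ u ∈ ball (0 : Fin (d + 1) → Site (PV d ℓ i.m i.K hd hL) 0 → 𝔸) Rc, ∀ z s, qpsK i z s ≠ 0 →
      ‖(qpT i (parSymY i) (prodCfg U₀ η (fun μ y => ((w y : ℝ) : ℂ) • u μ y)) s z : 𝔸)‖ ≤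
        K₀ ^ ((d + 1) * ((ℓ + 1) ^ i.k - 1)) * Real.exp (((d : ℝ) + 1) * (|η| * Rc))) := by
  refine ⟨fun u hu s z hq => ?_, fun u hu s z hq => ?_, fun u hu z s hq => ?_, fun u hu z s hq => ?_⟩
  · rw [qpT_parSymY_eq_of_blkOf_eq i _ (qpK_ne_zero_imp i hq)]
    exact norm_parTaxiV_scaledPencil_corner_le i U₀ η w hU hUi hK1 hRc hw hu (qpK_ne_zero_imp i hq)
  · rw [qpT_parSymY_eq_of_blkOf_eq i _ (qpK_ne_zero_imp i hq)]
    exact norm_parTaxiV_inv_scaledPencil_corner_le i U₀ η w hU hUi hK1 hRc hw hu (qpK_ne_zero_imp i hq)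
  · rw [qpT_parSymY_eq_of_blkOf_eq i _ (qpsK_ne_zero_imp i hq)]
    exact norm_parTaxiV_inv_scaledPencil_corner_le i U₀ η w hU hUi hK1 hRc hw hu (qpsK_ne_zero_imp i hq)
  · rw [qpT_parSymY_eq_of_blkOf_eq i _ (qpsK_ne_zero_imp i hq)]
    exact norm_parTaxiV_scaledPencil_corner_le i U₀ η w hU hUi hK1 hRc hw hu (qpsK_ne_zero_imp i hq)

/-! ## §2. Holomorphy along the scaled pencil (`hQh ∕ hQhi`) -/

omit [NormedAlgebra ℂ 𝔸] [CompleteSpace 𝔸] [NormOneClass 𝔸] in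
/-- the per-block weight bound implies `|w| ≤ 1`. [cite: Balaban1985BackgroundPropagators, (3.37) p.396, bookkeeping] -/
theorem abs_weight_le_one (hw : ∀ y, |w y| ≤ ((((ℓ : ℝ) + 1) ^ (blkOf i.D.toDomains (toBox i.hN y)).1.1))⁻¹) (y : Site (PV d ℓ i.m i.K hd hL) 0) :
    |w y| ≤ 1 := by
  have hL1 : (1 : ℝ) ≤ (ℓ : ℝ) + 1 := by linarith [Nat.cast_nonneg (α := ℝ) ℓ]
  exact (hw y).trans (inv_le_one_of_one_le₀ (one_le_pow₀ hL1))

omit [NormOneClass 𝔸] in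
/-- ★ **`A″ ↦ U(Γ_{x,x′})` AT `U = e^{iη·w·A″}U₀` IS HOLOMORPHIC ON THE CHART BALL** (pv27's pencil holomorphy composed with the linear scaling, which maps the ball into
itself). [cite: Balaban1985BackgroundPropagators, (3.40) p.397, Thm 3.4 p.400; Balaban1988RG2Cluster, p.15] -/
theorem differentiableOn_parTaxiV_scaledPencil (hw : ∀ y, |w y| ≤ ((((ℓ : ℝ) + 1) ^ (blkOf i.D.toDomains (toBox i.hN y)).1.1))⁻¹)
    (x x' : Site (PV d ℓ i.m i.K hd hL) 0) :
    DifferentiableOn ℂ (fun u : Fin (d + 1) → Site (PV d ℓ i.m i.K hd hL) 0 → 𝔸 =>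
      (parTaxiV (prodCfg U₀ η (fun μ y => ((w y : ℝ) : ℂ) • u μ y)) x x' : 𝔸)) (ball 0 Rc) :=
  (differentiableOn_parTaxiV_prodCfg U₀ η (Rc := Rc) x x').comp (differentiable_weightScale i w).differentiableOn
    (mapsTo_weightScale_ball i w (abs_weight_le_one i w hw))

omit [NormOneClass 𝔸] in
/-- ★ **… and the inverse word.** [cite: Balaban1985BackgroundPropagators, (3.5) p.391, (3.40) p.397, Thm 3.4 p.400] -/
theorem differentiableOn_parTaxiV_inv_scaledPencil (hw : ∀ y, |w y| ≤ ((((ℓ : ℝ) + 1) ^ (blkOf i.D.toDomains (toBox i.hN y)).1.1))⁻¹)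
    (x x' : Site (PV d ℓ i.m i.K hd hL) 0) :
    DifferentiableOn ℂ (fun u : Fin (d + 1) → Site (PV d ℓ i.m i.K hd hL) 0 → 𝔸 =>
      (((parTaxiV (prodCfg U₀ η (fun μ y => ((w y : ℝ) : ℂ) • u μ y)) x x')⁻¹ : 𝔸ˣ) : 𝔸)) (ball 0 Rc) :=
  (differentiableOn_parTaxiV_inv_prodCfg U₀ η (Rc := Rc) x x').comp (differentiable_weightScale i w).differentiableOn
    (mapsTo_weightScale_ball i w (abs_weight_le_one i w hw))

omit [NormOneClass 𝔸] in
/-- ★ **`hQh ∧ hQhi` AT THE v4 LETTER `parSymY` ALONG THE SCALED PENCIL** (both branches of the symmetrisation are taxicab words or their inverses).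
[cite: Balaban1985BackgroundPropagators, (3.19), (3.21), (3.24) pp.393–394, (3.40) p.397, Thm 3.4 p.400] -/
theorem differentiableOn_qpT_parSymY_scaledPencil (hw : ∀ y, |w y| ≤ ((((ℓ : ℝ) + 1) ^ (blkOf i.D.toDomains (toBox i.hN y)).1.1))⁻¹)
    (s : BlkY i) (z : SiteY i) :
    DifferentiableOn ℂ (fun u : Fin (d + 1) → Site (PV d ℓ i.m i.K hd hL) 0 → 𝔸 =>
        (qpT i (parSymY i) (prodCfg U₀ η (fun μ y => ((w y : ℝ) : ℂ) • u μ y)) s z : 𝔸)) (ball 0 Rc) ∧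
      DifferentiableOn ℂ (fun u : Fin (d + 1) → Site (PV d ℓ i.m i.K hd hL) 0 → 𝔸 =>
        (((qpT i (parSymY i) (prodCfg U₀ η (fun μ y => ((w y : ℝ) : ℂ) • u μ y)) s z)⁻¹ : 𝔸ˣ) : 𝔸)) (ball 0 Rc) := by
  by_cases hle : toLex (blkCornerY i s).1 ≤ toLex z.1
  · have e1 : (fun u : Fin (d + 1) → Site (PV d ℓ i.m i.K hd hL) 0 → 𝔸 =>
        (qpT i (parSymY i) (prodCfg U₀ η (fun μ y => ((w y : ℝ) : ℂ) • u μ y)) s z : 𝔸)) =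
        fun u => (parTaxiV (prodCfg U₀ η (fun μ y => ((w y : ℝ) : ℂ) • u μ y)) ((boxEquiv i.hN).symm (blkCornerY i s))
          ((boxEquiv i.hN).symm z) : 𝔸) := funext fun u => by
      show ((parSymY i _ (blkCornerY i s) z : 𝔸ˣ) : 𝔸) = _; rw [parSymY_of_le hle]; rfl
    have e2 : (fun u : Fin (d + 1) → Site (PV d ℓ i.m i.K hd hL) 0 → 𝔸 =>
        (((qpT i (parSymY i) (prodCfg U₀ η (fun μ y => ((w y : ℝ) : ℂ) • u μ y)) s z)⁻¹ : 𝔸ˣ) : 𝔸)) =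
        fun u => (((parTaxiV (prodCfg U₀ η (fun μ y => ((w y : ℝ) : ℂ) • u μ y)) ((boxEquiv i.hN).symm (blkCornerY i s))
          ((boxEquiv i.hN).symm z))⁻¹ : 𝔸ˣ) : 𝔸) := funext fun u => by
      show ((((parSymY i _ (blkCornerY i s) z)⁻¹ : 𝔸ˣ)) : 𝔸) = _; rw [parSymY_of_le hle]; rfl
    rw [e1, e2]
    exact ⟨differentiableOn_parTaxiV_scaledPencil i U₀ η w hw _ _, differentiableOn_parTaxiV_inv_scaledPencil i U₀ η w hw _ _⟩
  · have e1 : (fun u : Fin (d + 1) → Site (PV d ℓ i.m i.K hd hL) 0 → 𝔸 =>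
        (qpT i (parSymY i) (prodCfg U₀ η (fun μ y => ((w y : ℝ) : ℂ) • u μ y)) s z : 𝔸)) =
        fun u => (((parTaxiV (prodCfg U₀ η (fun μ y => ((w y : ℝ) : ℂ) • u μ y)) ((boxEquiv i.hN).symm z)
          ((boxEquiv i.hN).symm (blkCornerY i s)))⁻¹ : 𝔸ˣ) : 𝔸) := funext fun u => by
      show ((parSymY i _ (blkCornerY i s) z : 𝔸ˣ) : 𝔸) = _; rw [parSymY_of_not_le hle]; rfl
    have e2 : (fun u : Fin (d + 1) → Site (PV d ℓ i.m i.K hd hL) 0 → 𝔸 =>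
        (((qpT i (parSymY i) (prodCfg U₀ η (fun μ y => ((w y : ℝ) : ℂ) • u μ y)) s z)⁻¹ : 𝔸ˣ) : 𝔸)) =
        fun u => (parTaxiV (prodCfg U₀ η (fun μ y => ((w y : ℝ) : ℂ) • u μ y)) ((boxEquiv i.hN).symm z)
          ((boxEquiv i.hN).symm (blkCornerY i s)) : 𝔸) := funext fun u => by
      show ((((parSymY i _ (blkCornerY i s) z)⁻¹ : 𝔸ˣ)) : 𝔸) = _; rw [parSymY_of_not_le hle, inv_inv]; rfl
    rw [e1, e2]
    exact ⟨differentiableOn_parTaxiV_inv_scaledPencil i U₀ η w hw _ _, differentiableOn_parTaxiV_scaledPencil i U₀ η w hw _ _⟩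

end Scaled

/-! ## §3. ★★★ The record's corollary: `G ≤ U(N)`, `G`-valued `U₀` — `K₀ = 1`, so the ONE numeral `e^{(d+1)|η|Rc}` sees neither the member, nor the level, nor `k` -/

section Record

variable {N : ℕ} [NeZero N] {G : Subgroup (Matrix (Fin N) (Fin N) ℂ)ˣ}

/-- ★★★ **THE X-STATION's TRANSPORTER BINDERS ALONG THE SCALED PENCIL ABOUT A UNITARY-VALUED BACKGROUND, ONE LEVEL-FREE NUMBER**: for `G ≤ U(N)`, a `G`-valued `U₀`, a
weight `|w| ≤ (L^{lev})⁻¹` blockwise and `0 ≤ Rc`: `hQf ∕ hQb ∕ hQsf ∕ hQsb` at `parSymY` hold with `KQ = e^{(d+1)|η|Rc}` (the lane's corollary of record I.39586).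
[cite: Balaban1985BackgroundPropagators, (3.19), (3.21), (3.24) pp.393–394, (3.35)–(3.37) p.396, (3.40) p.397; Balaban1988RG2Cluster, p.15] -/
theorem norm_qpT_parSymY_scaledPencil_binders_of_mem (hG : G ≤ B7Prop2Explicit.unitaryUnits (Matrix (Fin N) (Fin N) ℂ))
    {U₀ : CfgY (Matrix (Fin N) (Fin N) ℂ) i} (hU : ∀ μ x, U₀ μ x ∈ G) (η : ℝ) {Rc : ℝ} (hRc : 0 ≤ Rc) (w : Site (PV d ℓ i.m i.K hd hL) 0 → ℝ)
    (hw : ∀ y, |w y| ≤ ((((ℓ : ℝ) + 1) ^ (blkOf i.D.toDomains (toBox i.hN y)).1.1))⁻¹) :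
    (∀ u ∈ ball (0 : Fin (d + 1) → Site (PV d ℓ i.m i.K hd hL) 0 → Matrix (Fin N) (Fin N) ℂ) Rc, ∀ s z, qpK i s z ≠ 0 →
      ‖(qpT i (parSymY i) (prodCfg U₀ η (fun μ y => ((w y : ℝ) : ℂ) • u μ y)) s z : Matrix (Fin N) (Fin N) ℂ)‖ ≤
        Real.exp (((d : ℝ) + 1) * (|η| * Rc))) ∧
    (∀ u ∈ ball (0 : Fin (d + 1) → Site (PV d ℓ i.m i.K hd hL) 0 → Matrix (Fin N) (Fin N) ℂ) Rc, ∀ s z, qpK i s z ≠ 0 →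
      ‖(((qpT i (parSymY i) (prodCfg U₀ η (fun μ y => ((w y : ℝ) : ℂ) • u μ y)) s z)⁻¹ : (Matrix (Fin N) (Fin N) ℂ)ˣ) :
        Matrix (Fin N) (Fin N) ℂ)‖ ≤ Real.exp (((d : ℝ) + 1) * (|η| * Rc))) ∧
    (∀ u ∈ ball (0 : Fin (d + 1) → Site (PV d ℓ i.m i.K hd hL) 0 → Matrix (Fin N) (Fin N) ℂ) Rc, ∀ z s, qpsK i z s ≠ 0 →
      ‖(((qpT i (parSymY i) (prodCfg U₀ η (fun μ y => ((w y : ℝ) : ℂ) • u μ y)) s z)⁻¹ : (Matrix (Fin N) (Fin N) ℂ)ˣ) :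
        Matrix (Fin N) (Fin N) ℂ)‖ ≤ Real.exp (((d : ℝ) + 1) * (|η| * Rc))) ∧
    (∀ u ∈ ball (0 : Fin (d + 1) → Site (PV d ℓ i.m i.K hd hL) 0 → Matrix (Fin N) (Fin N) ℂ) Rc, ∀ z s, qpsK i z s ≠ 0 →
      ‖(qpT i (parSymY i) (prodCfg U₀ η (fun μ y => ((w y : ℝ) : ℂ) • u μ y)) s z : Matrix (Fin N) (Fin N) ℂ)‖ ≤
        Real.exp (((d : ℝ) + 1) * (|η| * Rc))) := by
  obtain ⟨hU1, hUi1⟩ := norm_unit_le_one_of_mem i hG hU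
  have h := norm_qpT_parSymY_scaledPencil_binders i U₀ η w hU1 hUi1 le_rfl hRc hw
  simp only [one_pow, one_mul] at h
  exact h

end Record

end Literature.MathematicalPhysics.QuantumFieldTheory.Balaban1983to89.B13ScaledPencilAveraging

end
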